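import Summits.QuantumFields.YangMills.Theorems.BalabanUVNodesN18U3GuardsAtKernels
import Literature.MathematicalPhysics.QuantumFieldTheory.Balaban1983to89.Beta.RemainderChain
import HarnessLib

/-!
# BalabanUVNodes ∕ node N18 = NE5 — IS «β₁₃ OF RECORD NOT BOXWISE CONSTANT» FORCED BY THE DISPLAYED ROWS?  NO: THE ONE-LOOP TRUNCATION
# MEETS EVERY β-LETTER OF THE TREE AND IS BOXWISE CONSTANT; UNDER THE ANCHOR THE MISSING LETTER IS EXACTLY «THE (2.13) REMAINDER'S (1.22) SECOND
# MOMENT DOES NOT VANISH IDENTICALLY ON THE WINDOW» (two-loop type, unprinted); WHAT THIS MEANS FOR K3⁷ v3's `KeyedSensitive` UNDER THE PIN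

Cell `pub-ymgap`, width seat `pub-ymgap-dag-n18-w2` (g2; HUMAN RULING D-0149 ∕ director-ym №197), plan g81 № 13 (pub-ymgap INBOX l.26426, first refusal n18-w2):
«decide whether `Provisos₁₃CoPH F 2 θ` + the N14 guard force `¬ YMDAG.N18.U3Guards.BoxwiseConstant θ.γ (betaOfRecord₁₃ F 2 θ.toStage13Params)`; YES ⇒ file it; NO ⇒
exhibit the admissible θ with boxwise-constant β₁₃ ∕ name the missing letter».  `--supports stmt-QuantumFields-20544` (K3⁷ `SpineGivenEndpointR13SepCoPH`) AS A
HELPER — count-neutral.  Definition lane by content: three hypothesis SHAPES (`constHBeta`, `oneLoopSplitConst`, `RemainderNonvanishingOnBoxes` — asserted for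
nothing) + kernel theorems over tree declarations BY NAME.

THE READING (why the answer is NO ∕ NOT FORCED, and not decidable either way from anything displayed).
* ON a box `]0, θ.γ]^{k+1}` the β of record IS the merged β: `betaOfRecord₁₃ F N θ k v = betaMerged … k v = secondMoment (polLimit F (k+1) (K ↦ 𝓝ₖ(v, K)) θ.ρ8 θ.bV) 0 1`
  with `𝓝 = mergedTermFamilyMatT F N (TβOfRecord₁₃ F N) (chiβOfRecord₁₃ F N θ) θ.εbg` the (1.6) merged new term of record (`Node00/Record13` :180, `Node00/BetaOfRecord`;
  §3 `betaOfRecord₁₃_of_mem_box`).  `polLimit` is a TOTAL `limUnder atTop` ((1.21) «T ↗ Z^d», its existence NOT asserted), `secondMoment` a `tsum`.  Hence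
  `BoxwiseConstant θ.γ β₁₃` is, verbatim, a statement about the HISTORY-DEPENDENCE OF THE (1.22) SECOND MOMENTS OF THE (1.21) LIMITING KERNELS of the merged term of
  record (§3 ★ `boxwiseConstant_betaOfRecord₁₃_iff_secondMoment`) — an ESTIMATE-grade property of Bałaban's effective actions, in either direction.
* The rows named in № 13 carry NO such estimate: `Provisos₁₃CoPH` = `intPiece ∕ measω ∕ measChi ∕ zetaUnity ∕ zetaAbs ∕ rstep ∕ rzLaws ∕ zhLaws ∕ zhLocal`
  (integrability ∕ measurability ∕ laws of the 𝐓-step; `Node00/Record13CoPH` :410); the N14 guard `ZhUnity ∧ SlotsNondegenerate₁₃` (unity of the history-indexed 𝐓-weight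
  factor; present slots `≠ 0`); `Admissible` (sign clauses + the CHART PIN `IsChartOfRecord cβ`, `0 < cβ` since Stage 9 — so the zero-chart door `ρ8 := 0` of
  `Node00/Record8Inhabited`, under which β₁₃ would vanish identically, IS closed: §3 `rho8_ne_zero_of_admissible₁₃`, kernel; no other row reads the β-chart data).  They READ β₁₃ (through the generated history
  `gOfRecord₁₃ = genSeq β₁₃ g₀`) but bound nothing about it.  An unconditional NO-MODEL (a guarded admissible θ with boxwise-constant β₁₃) would need `Provisos₁₃CoPH`
  INHABITED — K0⁷'s content — and is NOT claimed here.
* §1 INDEPENDENCE FROM EVERY β-LETTER OF THE TREE (kernel): the ONE-LOOP TRUNCATION `constHBeta b := fun k _ ↦ b k` is boxwise constant and satisfies `BetaContH`,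
  `BetaUpperH` ∕ `BetaLowerH` (bounded `b`), `B12Beta.OneLoopSplit` (`β1 := 0`, `oneLoopSplitConst`), `Beta.RemainderChain.RemainderConst … 0`, K2⁷'s `ConstRemainder β b 0 γ₀`,
  `BoxRemainder β b 0 γ₀`, `ScaleAnchor β b` — hence the three conjuncts of K2⁷ line 1′'s letter `RemAt` with `s = 0`; the drift letters (`OneLoopDrift`, `D1Drift`) read
  the reference numbers `b` only and are untouched (★ `exists_boxwiseConstant_meeting_betaLetters`).  So NO conjunction of β-letters displayed anywhere in the tree forces
  `¬ BoxwiseConstant`.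
* §2 THE MISSING LETTER, EXACTLY: `RemainderNonvanishingOnBoxes γ β b := ∃ k, ∃ v ∈ ]0,γ]^{k+1}, β k v ≠ b k`.  Under a per-scale anchor `ScaleAnchor β b` (K2⁷ v4's own
  letter at `b = θ.cβ • beta0OfJs F κ`): ★ `not_boxwiseConstant_iff_remainderNonvanishingOnBoxes` and ★ `boxwiseConstant_iff_eq_anchor_on_boxes` — β is boxwise constant
  IFF it IS its one-loop truncation on every box, i.e. IFF the (2.13)-remainder's (1.22) second moment vanishes identically on the window.  [Balaban1987RG1] bounds that
  remainder from ABOVE only ((2.13) «vanishes at g_k = 0» p. 268; §1 p. 264; (5.10) p. 293) and never needs a lower bound: the letter is of TWO-LOOP type, UNPRINTED and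
  UNNEEDED by print.
* §3 AT THE RECORD: the box face, the exact reading, term-family-blind ⇒ degenerate; under an anchor of the record's β (★★
  `not_boxwiseConstant_betaOfRecord₁₃_iff_of_scaleAnchor`, `boxwiseConstant_betaOfRecord₁₃_iff_eq_anchor_of_scaleAnchor` — at `N = 2` K2⁷ line 1′'s letter of record
  `RemAt F κ θ hP c` (p593586) supplies the anchor at `b = fun k ↦ c * beta0OfJs F κ k` by `remAt_iff_hPFree`); §3b the K3⁷ v3 conclusion shape under the node-U3 pin
  `U3PinnedKernels`: ★★ `sensitiveOnBoxes_rateCarriers_of_kernels_pin_of_remainderNonvanishing` (anchor + missing letter ⇒ `KeyedSensitive`'s conclusion, via p592505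
  `sensitiveOnBoxes_rateCarriers_of_kernels_pin`) and `betaOfRecord₁₃_eq_anchor_of_blind_kernels_pin` (a pinned bundle BLIND over the boxes ⇒ β₁₃ IS its one-loop truncation on
  the window).  K2⁷'s shapes `ScaleAnchor` ∕ `ConstRemainder` ∕ `BoxRemainder` enter VERBATIM as inline binders (definitional) — their home modules import the route file
  and are not imported here (gate lint `theses-cone`).
CONSEQUENCE FOR K3⁷ v3 (02f6f498332fdbee), LOCATED: under `U3PinnedKernels` the conjunct `KeyedSensitive` is no longer a junk filter (the pin itself excludes evidence #5's
`junkU3` ∕ King towers) but an OBLIGATION to prove an unprinted non-degeneracy of the record at every guarded admissible tuple.  Options (the plan's call): drop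
`KeyedSensitive` from `GuardedReading` (p584126 ∕ p592505 stay as the dictionary), or key it at the tuple by the antecedent `¬ BoxwiseConstant θ.γ (betaOfRecord₁₃ F 2 θ…)`
(then BY NAME from p592505, vacuous at degenerate tuples); a proviso edition ASSERTING `¬ BoxwiseConstant` would display an unprinted two-loop fact as a hypothesis of R4.

A6 (№189) — SATISFIABILITY.  §1's letters are jointly inhabited by `constHBeta b` itself (that is the point); §2's binders `ScaleAnchor β b ∧ RemainderNonvanishingOnBoxes γ β b`
are jointly inhabited IN THIS FILE by `β k v := b k + v (Fin.last k)` (`exists_anchor_and_remainderNonvanishingOnBoxes`); §3's anchor `hA` ∕ pin `hpin` are K2⁷'s (`RemAt`) ∕ K3⁷'s (`U3PinnedKernels`) displayed hypotheses,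
inhabited by nothing here (LOCATED).

HONEST FRAMING.  Count-neutral helper: shapes + kernel bookkeeping + a located decision; NOTHING of Bałaban's is asserted; `¬ BoxwiseConstant θ.γ β₁₃` is NEITHER proved NOR
refuted at the record (not decidable from the displayed rows; unprinted); NE5 ∕ (D4) NOT PRINTED for d = 4 ∕ NOT proved; N18 NOT discharged; K3⁷ OPEN, not claimed; no count
claim; counts UNMOVED (typed 28∕28 · discharged 5∕27 (A 5∕28)).  One finite four-torus programme at fixed `ε`, Bałaban as printed; R4 closes the conditional finite-𝕋⁴ rung
`BalabanLadder.UV` only — NOT ℝ⁴, NOT infinite volume, NOT OS, NOT a mass gap, NOT Clay.  No `sorry`, no `instance`, no `notation`, no `structure`.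
-/

set_option autoImplicit false

noncomputable section

namespace YMDAG.N18.BetaBoxDegeneracy

open scoped Matrix.Norms.L2Operator
open Literature.MathematicalPhysics.QuantumFieldTheory.Balaban1983to89
open Literature.MathematicalPhysics.QuantumFieldTheory.Balaban1983to89.T4Continuum (T4Family ULoop)
open Literature.MathematicalPhysics.QuantumFieldTheory.Balaban1983to89.FlowStep (Box HBeta mem_box BetaUpperH BetaLowerH BetaContH)
open Literature.MathematicalPhysics.QuantumFieldTheory.Balaban1983to89.B12Beta (HistBox OneLoopSplit secondMoment)
open Literature.MathematicalPhysics.QuantumFieldTheory.Balaban1983to89.Beta.RemainderChain (RemainderConst)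
open Literature.MathematicalPhysics.QuantumFieldTheory.Balaban1983to89.Node00 (Stage13Params Stage13HParams U3Letters₁₁ betaOfRecord₁₃ betaMerged betaOfMerged
  betaOfMerged_of_mem mergedTermFamilyMatT TβOfRecord₁₃ chiβOfRecord₁₃ polLimit TermFamily1)
open Literature.MathematicalPhysics.QuantumFieldTheory.Balaban1983to89.Node00.U3OfKernels (objectsOfRecord₁₃)
open YMDAG.UVSplit
open YMDAG.N18.U3Guards (BoxwiseConstant BlindOnBoxes SensitiveOnBoxes)
open YMDAG.N18.U3GuardsAtKernels (sensitiveOnBoxes_rateCarriers_of_kernels_pin boxwiseConstant_betaOfRecord₁₃_of_blind_kernels_pin)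

/-! ## §1 The one-loop truncation is boxwise constant and meets every β-letter of the tree (the independence certificate) -/

section Truncation

/-- **THE ONE-LOOP TRUNCATION** (shape): the history-BLIND β-family `β_{k+1}(g_0,…,g_k) := b_k` — print's β with the (2.13)-remainder's contribution to (1.22) DROPPED
(the idealised one-loop flow `1/g²_{k+1} = 1/g²_k − b_k`).  The test object of this file; asserted for nothing. [folklore] -/
@[folklore]
def constHBeta (b : ℕ → ℝ) : HBeta := fun k _ => b k

/-- Unfolding (`rfl`). [folklore] -/
@[simp] theorem constHBeta_apply (b : ℕ → ℝ) (k : ℕ) (v : Fin (k + 1) → ℝ) : constHBeta b k v = b k := rfl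

/-- The one-loop truncation IS boxwise constant (every window `γ`). [folklore] -/
theorem boxwiseConstant_constHBeta (γ : ℝ) (b : ℕ → ℝ) : BoxwiseConstant γ (constHBeta b) := fun _ _ _ _ _ => rfl

/-- It meets `BetaContH` ([I] p. 263–264 smoothness clause, as typed). [folklore] -/
theorem betaContH_constHBeta (γ : ℝ) (b : ℕ → ℝ) : BetaContH γ (constHBeta b) := fun _ => continuousOn_const

/-- It meets `BetaUpperH β'` for any bound `b_k ≤ β'` ([I] p. 264 «uniformly bounded», as typed). [folklore] -/
theorem betaUpperH_constHBeta {b : ℕ → ℝ} {β' : ℝ} (γ : ℝ) (hb : ∀ k, b k ≤ β') : BetaUpperH β' γ (constHBeta b) := fun k _ _ => hb k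

/-- It meets `BetaLowerH c` for any bound `c ≤ b_k` (the sign ∕ asymptotic-freedom letter, as typed). [folklore] -/
theorem betaLowerH_constHBeta {b : ℕ → ℝ} {c : ℝ} (γ : ℝ) (hb : ∀ k, c ≤ b k) : BetaLowerH c γ (constHBeta b) := fun k _ _ => hb k

/-- It carries print's ONE-LOOP SPLIT ([I] (2.12)–(2.14) p. 268, `B12Beta.OneLoopSplit`) with `β⁰ := b` and the remainder `β¹ := 0` (which vanishes at `g_k = 0`, indeed
everywhere).  A shape; asserted for nothing. [folklore] -/
@[folklore]
def oneLoopSplitConst (b : ℕ → ℝ) : OneLoopSplit (constHBeta b) where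
  β0 := b
  β1 := fun _ _ => 0
  split := fun _ _ => (add_zero _).symm
  vanish := fun _ _ _ => rfl

/-- The split's one-loop numbers ARE `b` (`rfl`). [folklore] -/
@[simp] theorem oneLoopSplitConst_β0 (b : ℕ → ℝ) : (oneLoopSplitConst b).β0 = b := rfl

/-- The split's remainder IS zero (`rfl`). [folklore] -/
@[simp] theorem oneLoopSplitConst_β1 (b : ℕ → ℝ) (k : ℕ) (p : Fin (k + 1) → ℝ) : (oneLoopSplitConst b).β1 k p = 0 := rfl

/-- It meets the k-uniform remainder bound `Beta.RemainderChain.RemainderConst` with modulus `0` (print's grade of [II] (2.41) → [I] (5.10) → (1.22), as typed). [folklore] -/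
theorem remainderConst_oneLoopSplitConst (b : ℕ → ℝ) (γ : ℝ) : RemainderConst (oneLoopSplitConst b) γ 0 := fun _ _ _ => by simp

/-- It meets K2⁷'s split-free CONSTANT REMAINDER with modulus `0` — VERBATIM the body of `ConstRemainder (constHBeta b) b 0 γ₀` of `Thm/BalabanUVNodesK2NamedJetsRemAt`
(definitional; that module is not imported, to keep this file out of the Theses cone). [folklore] -/
theorem constRemainder_constHBeta (b : ℕ → ℝ) (γ₀ : ℝ) :
    ∀ (k : ℕ) (p : Fin (k + 1) → ℝ), p ∈ HistBox γ₀ k → |constHBeta b k p - b k| ≤ 0 := fun _ _ _ => by simp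

/-- It meets K2⁷'s g-PROPORTIONAL BOX REMAINDER with constant `0` — VERBATIM the body of `BoxRemainder (constHBeta b) b 0 γ₀` of `Thm/BalabanUVNodesK2JsOfRecord`
(definitional). [folklore] -/
theorem boxRemainder_constHBeta (b : ℕ → ℝ) (γ₀ : ℝ) :
    ∀ (k : ℕ) (p : Fin (k + 1) → ℝ), p ∈ HistBox γ₀ k → |constHBeta b k p - b k| ≤ 0 * p (Fin.last k) := fun _ _ _ => by simp

/-- It meets K2⁷'s PER-SCALE ANCHOR at `b` — VERBATIM the body of `ScaleAnchor (constHBeta b) b` of `Thm/BalabanUVNodesK2NamedJetsRemAt` (definitional; box `]0, 1]` at every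
scale and tolerance). [folklore] -/
theorem scaleAnchor_constHBeta (b : ℕ → ℝ) :
    ∀ (k : ℕ) (δ : ℝ), 0 < δ → ∃ γ' : ℝ, 0 < γ' ∧ ∀ p : Fin (k + 1) → ℝ, p ∈ HistBox γ' k → |constHBeta b k p - b k| ≤ δ :=
  fun _ _ hδ => ⟨1, one_pos, fun _ _ => by simpa using hδ.le⟩

/-- **★ THE INDEPENDENCE CERTIFICATE**: for every window `γ`, every reference sequence `b` and bounds `c ≤ b_k ≤ β'`, there is a BOXWISE-CONSTANT β-family meeting
`BetaContH`, `BetaLowerH c`, `BetaUpperH β'`, `ConstRemainder β b 0 γ`, `BoxRemainder β b 0 γ`, `ScaleAnchor β b`, and carrying a `OneLoopSplit` with one-loop numbers `b` and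
`RemainderConst … γ 0` — namely the one-loop truncation.  (The drift letters `OneLoopDrift` ∕ `D1Drift` read `b` alone and are unaffected by truncation.)  Hence NO conjunction of the
β-letters displayed in the tree forces `¬ BoxwiseConstant`. [folklore] -/
theorem exists_boxwiseConstant_meeting_betaLetters (γ : ℝ) (b : ℕ → ℝ) (c β' : ℝ) (hlo : ∀ k, c ≤ b k) (hhi : ∀ k, b k ≤ β') :
    ∃ β : HBeta, BoxwiseConstant γ β ∧ BetaContH γ β ∧ BetaLowerH c γ β ∧ BetaUpperH β' γ β ∧
      (∀ (k : ℕ) (p : Fin (k + 1) → ℝ), p ∈ HistBox γ k → |β k p - b k| ≤ 0) ∧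
      (∀ (k : ℕ) (p : Fin (k + 1) → ℝ), p ∈ HistBox γ k → |β k p - b k| ≤ 0 * p (Fin.last k)) ∧
      (∀ (k : ℕ) (δ : ℝ), 0 < δ → ∃ γ' : ℝ, 0 < γ' ∧ ∀ p : Fin (k + 1) → ℝ, p ∈ HistBox γ' k → |β k p - b k| ≤ δ) ∧
      ∃ S : OneLoopSplit β, S.β0 = b ∧ RemainderConst S γ 0 :=
  ⟨constHBeta b, boxwiseConstant_constHBeta γ b, betaContH_constHBeta γ b, betaLowerH_constHBeta γ hlo, betaUpperH_constHBeta γ hhi,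
    constRemainder_constHBeta b γ, boxRemainder_constHBeta b γ, scaleAnchor_constHBeta b, oneLoopSplitConst b, rfl, remainderConst_oneLoopSplitConst b γ⟩

end Truncation

/-! ## §2 The missing letter: non-vanishing of the remainder on the boxes; under the anchor it IS β-non-degeneracy -/

section MissingLetter

variable {γ : ℝ} {β : HBeta} {b : ℕ → ℝ}

/- The PER-SCALE ANCHOR of `β` at `b` as an inline binder — VERBATIM the body of K2⁷'s `ScaleAnchor β b` (`Thm/BalabanUVNodesK2NamedJetsRemAt`, definitional; its letter of
record `RemAt F κ θ hP c` carries it at `b = fun k ↦ c * beta0OfJs F κ k`, `remAt_iff_hPFree`). -/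
variable (hA : ∀ (k : ℕ) (δ : ℝ), 0 < δ → ∃ γ' : ℝ, 0 < γ' ∧ ∀ p : Fin (k + 1) → ℝ, p ∈ HistBox γ' k → |β k p - b k| ≤ δ)

/-- **THE MISSING LETTER — THE REMAINDER DOES NOT VANISH IDENTICALLY ON THE BOXES** (shape): at SOME scale `k` and SOME history `v ∈ ]0,γ]^{k+1}` the β-function differs
from the reference number `b_k`.  For a β anchored at `b` (K2⁷'s `ScaleAnchor`, `b = θ.cβ • beta0OfJs F κ`) this says: the (1.22) second moment of the (2.13) remainder's limiting
kernel is not identically zero on the window — a LOWER-bound-type (two-loop) statement, bounded from ABOVE only in print ([Balaban1987RG1] (2.13) p. 268, §1 p. 264, (5.10) p. 293)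
and never used there.  Asserted for nothing. [folklore] -/
@[folklore]
def RemainderNonvanishingOnBoxes (γ : ℝ) (β : HBeta) (b : ℕ → ℝ) : Prop :=
  ∃ (k : ℕ) (v : Fin (k + 1) → ℝ), v ∈ Box γ k ∧ β k v ≠ b k

/-- The one-loop truncation FAILS the missing letter (consistency with §1). [folklore] -/
theorem not_remainderNonvanishingOnBoxes_constHBeta (γ : ℝ) (b : ℕ → ℝ) : ¬ RemainderNonvanishingOnBoxes γ (constHBeta b) b :=
  fun ⟨_, _, _, h⟩ => h rfl

/-- A β that is NOT boxwise constant differs, on some box, from ANY reference sequence. [folklore] -/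
theorem remainderNonvanishingOnBoxes_of_not_boxwiseConstant (h : ¬ BoxwiseConstant γ β) (b : ℕ → ℝ) : RemainderNonvanishingOnBoxes γ β b := by
  by_contra hn
  refine h fun k v v' hv hv' => ?_
  have h1 : β k v = b k := by
    by_contra h1
    exact hn ⟨k, v, hv, h1⟩
  have h2 : β k v' = b k := by
    by_contra h2
    exact hn ⟨k, v', hv', h2⟩
  rw [h1, h2]

include hA in
/-- **★ UNDER THE ANCHOR, THE MISSING LETTER FORCES β-NON-DEGENERACY**: if `β_{k+1} → b_k` at the zero history scale by scale (`ScaleAnchor β b`) and `β k v ≠ b k` at some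
`v ∈ ]0,γ]^{k+1}`, then `β k` is not constant on that box — the anchor supplies, inside the SAME box, a constant history near zero at which `β k` is within `|β k v − b k| ∕ 2`
of `b_k`. [folklore] -/
theorem not_boxwiseConstant_of_scaleAnchor (h : RemainderNonvanishingOnBoxes γ β b) : ¬ BoxwiseConstant γ β := by
  rintro hbc
  obtain ⟨k, v, hv, hne⟩ := h
  have hpos : 0 < |β k v - b k| / 2 := half_pos (abs_pos.mpr (sub_ne_zero.mpr hne))
  obtain ⟨γ', hγ', hanch⟩ := hA k _ hpos
  have hv0 := (mem_box.mp hv) 0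
  set p : Fin (k + 1) → ℝ := fun _ => min γ' (v 0) with hp
  have hpH : p ∈ HistBox γ' k := fun _ => ⟨lt_min hγ' hv0.1, min_le_left _ _⟩
  have hpB : p ∈ Box γ k := mem_box.mpr fun _ => ⟨lt_min hγ' hv0.1, (min_le_right _ _).trans hv0.2⟩
  have h1 := hanch p hpH
  rw [← hbc k v p hv hpB] at h1
  have h0 : |β k v - b k| = 0 := le_antisymm (by linarith) (abs_nonneg _)
  exact hne (sub_eq_zero.mp (abs_eq_zero.mp h0))

include hA in
/-- **★ UNDER THE ANCHOR, «NOT BOXWISE CONSTANT» IS EXACTLY THE MISSING LETTER.** [folklore] -/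
theorem not_boxwiseConstant_iff_remainderNonvanishingOnBoxes :
    ¬ BoxwiseConstant γ β ↔ RemainderNonvanishingOnBoxes γ β b :=
  ⟨fun h => remainderNonvanishingOnBoxes_of_not_boxwiseConstant h b, not_boxwiseConstant_of_scaleAnchor hA⟩

include hA in
/-- **★ UNDER THE ANCHOR, «BOXWISE CONSTANT» MEANS «β IS ITS ONE-LOOP TRUNCATION ON EVERY BOX»** (`β k v = b k` for all `v ∈ ]0,γ]^{k+1}`, all `k`): the (2.13)
remainder's (1.22) second moment vanishes identically on the window. [folklore] -/
theorem boxwiseConstant_iff_eq_anchor_on_boxes :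
    BoxwiseConstant γ β ↔ ∀ (k : ℕ) (v : Fin (k + 1) → ℝ), v ∈ Box γ k → β k v = b k := by
  constructor
  · intro h k v hv
    by_contra hne
    exact not_boxwiseConstant_of_scaleAnchor hA ⟨k, v, hv, hne⟩ h
  · intro h k v v' hv hv'
    rw [h k v hv, h k v' hv']

/-- **A6 (№189) — §2's BINDERS ARE JOINTLY SATISFIABLE**: for any reference sequence `b` and window `γ > 0`, the family `β k v := b k + v (Fin.last k)` (one-loop numbers plus
a remainder LINEAR in the last coupling) is anchored at `b` (box `]0, δ]` at tolerance `δ`), its remainder does not vanish on the window, and — by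
`not_boxwiseConstant_of_scaleAnchor` — it is not boxwise constant.  A test object, not a claim about any record. [folklore] -/
theorem exists_anchor_and_remainderNonvanishingOnBoxes (b : ℕ → ℝ) {γ : ℝ} (hγ : 0 < γ) :
    ∃ β : HBeta, (∀ (k : ℕ) (δ : ℝ), 0 < δ → ∃ γ' : ℝ, 0 < γ' ∧ ∀ p : Fin (k + 1) → ℝ, p ∈ HistBox γ' k → |β k p - b k| ≤ δ) ∧
      RemainderNonvanishingOnBoxes γ β b ∧ ¬ BoxwiseConstant γ β := by
  have hA : ∀ (k : ℕ) (δ : ℝ), 0 < δ → ∃ γ' : ℝ, 0 < γ' ∧ ∀ p : Fin (k + 1) → ℝ, p ∈ HistBox γ' k →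
      |(fun (k : ℕ) (v : Fin (k + 1) → ℝ) => b k + v (Fin.last k)) k p - b k| ≤ δ := by
    intro k δ hδ
    refine ⟨δ, hδ, fun p hp => ?_⟩
    have h := hp (Fin.last k)
    show |b k + p (Fin.last k) - b k| ≤ δ
    rw [add_sub_cancel_left, abs_of_pos h.1]
    exact h.2
  have hnv : RemainderNonvanishingOnBoxes γ (fun (k : ℕ) (v : Fin (k + 1) → ℝ) => b k + v (Fin.last k)) b :=
    ⟨0, fun _ => γ, mem_box.mpr fun _ => ⟨hγ, le_rfl⟩, (lt_add_of_pos_right (b 0) hγ).ne'⟩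
  exact ⟨_, hA, hnv, not_boxwiseConstant_of_scaleAnchor hA hnv⟩

end MissingLetter

/-! ## §3 At the Stage-13 record -/

section Record

variable {F : T4Family} {N : ℕ} [NeZero N] (θ : Stage13Params F N)

/-- **β₁₃ ON THE BOX IS THE MERGED β** (`Node00.betaOfMerged_of_mem`): for `v ∈ ]0, θ.γ]^{k+1}`,
`betaOfRecord₁₃ F N θ k v = betaMerged F 𝓝 θ.ρ8 θ.bV k v` with `𝓝` the merged term family of record — by definition the (1.22) second moment at directions `(0, 1)` of the
(1.21) `limUnder` kernel `polLimit F (k+1) (K ↦ 𝓝 k v K) θ.ρ8 θ.bV`. [folklore] -/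
theorem betaOfRecord₁₃_of_mem_box {k : ℕ} {v : Fin (k + 1) → ℝ} (hv : v ∈ Box θ.γ k) :
    betaOfRecord₁₃ F N θ k v =
      (letI := θ.instVβ₁; letI := θ.instVβ₂; letI := θ.instιβ
       betaMerged F (mergedTermFamilyMatT F N (TβOfRecord₁₃ F N) (chiβOfRecord₁₃ F N θ) θ.εbg) θ.ρ8 θ.bV k v) := by
  letI := θ.instVβ₁; letI := θ.instVβ₂; letI := θ.instιβ
  exact betaOfMerged_of_mem _ _ _ hv

/-- **★ THE EXACT CONTENT OF «β₁₃ BOXWISE CONSTANT ON THE WINDOW»**: at every scale, any two histories of one box `]0, θ.γ]^{k+1}` give the SAME (1.22) second moment of the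
(1.21) limiting kernel of the merged term of record — a statement about the history-dependence of Bałaban's limiting vacuum-polarisation kernels, nothing less. [folklore] -/
theorem boxwiseConstant_betaOfRecord₁₃_iff_secondMoment :
    BoxwiseConstant θ.γ (betaOfRecord₁₃ F N θ) ↔
      ∀ (k : ℕ) (v v' : Fin (k + 1) → ℝ), v ∈ Box θ.γ k → v' ∈ Box θ.γ k →
        (letI := θ.instVβ₁; letI := θ.instVβ₂; letI := θ.instιβ
         secondMoment (polLimit F (k + 1) (fun K => mergedTermFamilyMatT F N (TβOfRecord₁₃ F N) (chiβOfRecord₁₃ F N θ) θ.εbg k v K) θ.ρ8 θ.bV) 0 1 =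
           secondMoment (polLimit F (k + 1) (fun K => mergedTermFamilyMatT F N (TβOfRecord₁₃ F N) (chiβOfRecord₁₃ F N θ) θ.εbg k v' K) θ.ρ8 θ.bV) 0 1) := by
  letI := θ.instVβ₁; letI := θ.instVβ₂; letI := θ.instιβ
  constructor
  · intro h k v v' hv hv'
    have h' := h k v v' hv hv'
    rwa [betaOfRecord₁₃_of_mem_box θ hv, betaOfRecord₁₃_of_mem_box θ hv'] at h'
  · intro h k v v' hv hv'
    rw [betaOfRecord₁₃_of_mem_box θ hv, betaOfRecord₁₃_of_mem_box θ hv']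
    exact h k v v' hv hv'

/-- **A TERM FAMILY BLIND TO THE BOX HISTORIES GIVES A BOXWISE-CONSTANT β₁₃** (sufficient condition for degeneracy, kernel): if at every scale the merged term of record is the SAME
functional at any two histories of one box (at every approximation `K`), then β₁₃ is boxwise constant — e.g. a coupling-free effective action. [folklore] -/
theorem boxwiseConstant_betaOfRecord₁₃_of_termFamily_blind
    (h : ∀ (k : ℕ) (v v' : Fin (k + 1) → ℝ), v ∈ Box θ.γ k → v' ∈ Box θ.γ k → ∀ K : ℕ,
      mergedTermFamilyMatT F N (TβOfRecord₁₃ F N) (chiβOfRecord₁₃ F N θ) θ.εbg k v K =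
        mergedTermFamilyMatT F N (TβOfRecord₁₃ F N) (chiβOfRecord₁₃ F N θ) θ.εbg k v' K) :
    BoxwiseConstant θ.γ (betaOfRecord₁₃ F N θ) := by
  rw [boxwiseConstant_betaOfRecord₁₃_iff_secondMoment]
  intro k v v' hv hv'
  rw [show (fun K => mergedTermFamilyMatT F N (TβOfRecord₁₃ F N) (chiβOfRecord₁₃ F N θ) θ.εbg k v K) =
      fun K => mergedTermFamilyMatT F N (TβOfRecord₁₃ F N) (chiβOfRecord₁₃ F N θ) θ.εbg k v' K from funext (h k v v' hv hv')]

/-- **THE ZERO-CHART DOOR IS CLOSED AT EVERY ADMISSIBLE STAGE-13 TUPLE (`2 ≤ N`)**: Stage-13 admissibility carries Stage 9's CHART CLAUSE OF RECORD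
`IsChartOfRecord cβ` with `0 < cβ` (`Node00/Record9` :116, `Stage9Params.Admissible.chart`), hence `θ.ρ8 ≠ 0` (`Record8Chart.IsChartOfRecord.rho8_ne_zero`).  So the one
KERNEL-VISIBLE degenerate direction — `Node00/Record8Inhabited`'s zero chart `ρ8 := 0`, at which the β of record vanishes identically and is trivially boxwise constant — is NOT
available at a guarded admissible tuple: the admissibility chain 8 → 13 is NOT chart-blind (correcting a reading on the cell bus, pub-ymgap INBOX l.26829), and a NO-model for
№ 13 cannot be the zero-chart twin of an admissible tuple. [folklore] -/
theorem rho8_ne_zero_of_admissible₁₃ (hN : 2 ≤ N) (h : θ.Admissible F N) : (letI := θ.instVβ₁; letI := θ.instVβ₂; θ.ρ8) ≠ 0 :=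
  h.toStage9.chart.2.rho8_ne_zero h.toStage9.chart.1 hN

/-- **★★ UNDER AN ANCHOR OF THE RECORD's β, NON-DEGENERACY IS THE MISSING LETTER** (§2 at `β := betaOfRecord₁₃ F N θ`).  At `N = 2` K2⁷ line 1′'s letter of record
`RemAt F κ θ hP c` (p593586) supplies `hA` at `b = fun k ↦ c * beta0OfJs F κ k` (its `ScaleAnchor` conjunct, `remAt_iff_hPFree`): under that letter the N18 β-road reads
«β₁₃ − c·β⁰(Js) does not vanish identically on the window». [folklore] -/
theorem not_boxwiseConstant_betaOfRecord₁₃_iff_of_scaleAnchor {b : ℕ → ℝ}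
    (hA : ∀ (k : ℕ) (δ : ℝ), 0 < δ → ∃ γ' : ℝ, 0 < γ' ∧ ∀ p : Fin (k + 1) → ℝ, p ∈ HistBox γ' k → |betaOfRecord₁₃ F N θ k p - b k| ≤ δ) :
    ¬ BoxwiseConstant θ.γ (betaOfRecord₁₃ F N θ) ↔ RemainderNonvanishingOnBoxes θ.γ (betaOfRecord₁₃ F N θ) b :=
  not_boxwiseConstant_iff_remainderNonvanishingOnBoxes hA

/-- **… AND DEGENERACY MEANS «β₁₃ IS ITS ONE-LOOP TRUNCATION ON THE WINDOW»**: `β₁₃ k v = b k` for every `v ∈ ]0, θ.γ]^{k+1}`, every `k` (under `RemAt`: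
`β₁₃ ≡ c · beta0OfJs F κ` on the window — the (2.13) remainder's (1.22) second moment vanishes identically there). [folklore] -/
theorem boxwiseConstant_betaOfRecord₁₃_iff_eq_anchor_of_scaleAnchor {b : ℕ → ℝ}
    (hA : ∀ (k : ℕ) (δ : ℝ), 0 < δ → ∃ γ' : ℝ, 0 < γ' ∧ ∀ p : Fin (k + 1) → ℝ, p ∈ HistBox γ' k → |betaOfRecord₁₃ F N θ k p - b k| ≤ δ) :
    BoxwiseConstant θ.γ (betaOfRecord₁₃ F N θ) ↔ ∀ (k : ℕ) (v : Fin (k + 1) → ℝ), v ∈ Box θ.γ k → betaOfRecord₁₃ F N θ k v = b k :=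
  boxwiseConstant_iff_eq_anchor_on_boxes hA

end Record

/-! ## §3b The K3⁷ v3 conclusion shape under the node-U3 pin `U3PinnedKernels` (p592505's `hpin`, VERBATIM) -/

section Pinned

variable {N : ℕ} [NeZero N] (𝔯 : RateReading₁₃CoPH N) (ℓ : (F : T4Family) → Stage13HParams F N → U3Letters₁₁)
  (hpin : ∀ (F : T4Family) (θ : Stage13HParams F N) (hP : θ.Provisos₁₃CoPH F N) (g₀ : ℕ → ℝ) (os : List (ULoop F)),
    (𝔯.lit F θ hP g₀ os).u3 = objectsOfRecord₁₃ F N θ.toStage13Params (ℓ F θ))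

include hpin in
/-- **★★ `KeyedSensitive`'s CONCLUSION AT A TUPLE, FROM THE ANCHOR + THE MISSING LETTER**: at a reading pinned to the kernel objects of record, if the record's β is anchored at
`b` and its remainder relative to `b` does not vanish identically on the window, EVERY run-length bundle passes the node-U3 guard (p592505
`sensitiveOnBoxes_rateCarriers_of_kernels_pin` + §2 `not_boxwiseConstant_of_scaleAnchor`). [folklore] -/
theorem sensitiveOnBoxes_rateCarriers_of_kernels_pin_of_remainderNonvanishing (F : T4Family) (θ : Stage13HParams F N) (hP : θ.Provisos₁₃CoPH F N)
    {b : ℕ → ℝ} (hA : ∀ (k : ℕ) (δ : ℝ), 0 < δ → ∃ γ' : ℝ, 0 < γ' ∧ ∀ p : Fin (k + 1) → ℝ, p ∈ HistBox γ' k → |betaOfRecord₁₃ F N θ.toStage13Params k p - b k| ≤ δ)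
    (hnv : RemainderNonvanishingOnBoxes θ.γ (betaOfRecord₁₃ F N θ.toStage13Params) b) (g₀ : ℕ → ℝ) (os : List (ULoop F)) (k : ℕ) :
    SensitiveOnBoxes (rateCarriersOfRecord₁₃CoPH 𝔯 F θ hP g₀ os k).u3.EA θ.γ :=
  sensitiveOnBoxes_rateCarriers_of_kernels_pin 𝔯 ℓ hpin F θ hP (not_boxwiseConstant_of_scaleAnchor hA hnv) g₀ os k

include hpin in
/-- **THE FAILURE MODE UNDER THE PIN, READ THROUGH THE ANCHOR**: if SOME run-length bundle of the pinned reading is BLIND over the record's boxes, then the record's β IS its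
one-loop truncation on the window — `β₁₃ k v = b k` for all `v ∈ ]0, θ.γ]^{k+1}` (p592505 `boxwiseConstant_betaOfRecord₁₃_of_blind_kernels_pin` + §2). [folklore] -/
theorem betaOfRecord₁₃_eq_anchor_of_blind_kernels_pin (F : T4Family) (θ : Stage13HParams F N) (hP : θ.Provisos₁₃CoPH F N) {b : ℕ → ℝ}
    (hA : ∀ (k : ℕ) (δ : ℝ), 0 < δ → ∃ γ' : ℝ, 0 < γ' ∧ ∀ p : Fin (k + 1) → ℝ, p ∈ HistBox γ' k → |betaOfRecord₁₃ F N θ.toStage13Params k p - b k| ≤ δ)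
    (g₀ : ℕ → ℝ) (os : List (ULoop F)) (k : ℕ)
    (h : BlindOnBoxes (rateCarriersOfRecord₁₃CoPH 𝔯 F θ hP g₀ os k).u3.EA θ.γ)
    (k' : ℕ) (v : Fin (k' + 1) → ℝ) (hv : v ∈ Box θ.γ k') : betaOfRecord₁₃ F N θ.toStage13Params k' v = b k' :=
  (boxwiseConstant_iff_eq_anchor_on_boxes hA).mp (boxwiseConstant_betaOfRecord₁₃_of_blind_kernels_pin 𝔯 ℓ hpin F θ hP g₀ os k h) k' v hv

end Pinned

end YMDAG.N18.BetaBoxDegeneracy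

end
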